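/- Copyright: the b2b-balaban cell (near-miss cell 7), T⁴-continuum fan-out, row-NE7b OWNER lineage `t4-ne7b-p1` (gen 101) —
(α)-instance, THE END AT THE TOWER AT PRINT's ROUNDED RENEWAL LETTER, part 2: the road.  Released under the licence of the surrounding
project. -/
import Summits.QuantumFields.BalabanUV.T4Continuum.Support.B16HistoryTowerEndDataLWR
import Summits.QuantumFields.BalabanUV.T4Continuum.Support.HistoryRealiseCellsRunAssemblyWTVSLWLP82

/-!
# (α)-INSTANCE — THE END AT THE TOWER AT PRINT's ROUNDED RENEWAL LETTER, part 2: `TowerReadDataLWR.toLP82R` AND THE TERMINAL THEOREM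
`continuumYM4Torus_of_towerReadingLWR_fsc`

Summits-side support leaf of the T⁴-continuum cell (rung (B)+1 on a FINITE torus only; NOT infinite volume, NOT the mass gap, NOT
Clay; NOT a proof of NE7b — the cell's OWN estimate `T4WeightBudget.RelWeightBound`, NOT PRINTED, NOT PROVED).  [folklore]
composition BY NAME: three abbreviations (the tower's reading ∕ bundle ∕ operations), the plug at M5-2e's ledger re-proved over the
rounded record (LWLP82's `plug82L_of_histReadingLWL`, field for field), one `def` (the embedding `TowerReadDataLWR.toLP82R` into the
plug record `HistReadDataLP`, p300797's type) and one terminal theorem (= W4's `continuumYM4Torus_of_histReadingLP_fsc` ∘ the two-window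
junction ∘ `toLP82R` inside `ForSmallCouplings`); no `Prop` minted, nothing cited as hypothesis, zero `sorry`.

WHY ∕ WHAT (RULING R-ne7bp1-g101-5; part 1R's docstring has the located reason).  LWLP82's road `HistReadDataLWL.toLP82L` fills the plug
record's renewal letters `sR`∕`sR′` with the UNROUNDED `sRunr …` and its rounding rooms `hRR`∕`hRR′` with
`roundingRoomF_unrounded_of_inInterval` at `(t, Ap₁) := (d+3, ½γ₀A₁²∕T-envelope)`.  THIS road is the same text with `(t, Ap₁) := (d+5, 1)`:
`sR := sRrnd D O p₁ g₀ 𝒮.R` (print's `r_h = R_h^{−(d+5)}·p₁(g_h)²`, [B16] p. 383 «the largest factor among all the small factors … in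
the preparatory steps … we assume that 2p₁ − (d+5)r₀ > p₀»), `hRR := roundingRoomF_mono (hsB K) le_rfl (roundingRoomF_sharp_of_couplings
… )` at the threshold `ellStar C O F.L (O.d + 5) η η′ κ 1 Φ` (the M5 supply lemma at generic `(t, Ap₁)`, by name), the nine run-A slots
by the J-chain as in part 2 (`reprFam`, `densFam`, `holdsFam`, `𝒮.reading`, `factorsPinned` at `sRrnd`, `histRead_of_hwPinned`, `newOK_run`,
flow rows, `factorRead_factorsPinned`, `log_Λ_factorsPinned`), the volume side (`hplug`, `huV`, `wV`, `hwV`) exactly as LWLP82.  The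
terminal theorem binds TEN window letters `cΛ M Φ b₀ p₁ η η′ κ κ₂ κᵥ` (no `Lr`).  CONDITIONAL on everything the record displays; NE7b NOT
proved; count 0∕9.  HONEST DEPENDENCY (cell): continuum YM on T⁴ ⇐ BetaPertH ∧ nine spine estimates (0/9 proved); BetaPertH ⇐ (D1) ∧
(D4) ∧ CAP+tail; G-an2-4 gates asym, D1 and NE2/3/4.  This file changes none of it.
-/

open Finset MeasureTheory
open Literature.MathematicalPhysics.QuantumFieldTheory.Balaban1983to89
open T4PersistenceDictionary T4PersistentHistoryCount T4BankedInduction T4PrintedShapeBanking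
open T4WeightBudget T4GlobalDenominator T4LiveClassFibration T4LiveStructureGas T4LiveGasToTerms T4RecordPriceSeam
open T4PartnerMultiplicity T4IndicatorShell T4MatchingAssembly T4MatchingClosure T4MatchingClosureSocket T4Continuum
open T4StabilitySocket T4BranchingRecordsGas T4TaggedShapeBanking T4CanonicalMenus T4RenewalChains
open Summit.QuantumFields.BalabanUV.T4Continuum.PlacementBatch Summit.QuantumFields.BalabanUV.T4Continuum.PlacementSkeleton
open Summit.QuantumFields.BalabanUV.T4Continuum.CountThresholdUniform Summit.QuantumFields.BalabanUV.T4Continuum.CountThresholdExit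
open Summit.QuantumFields.BalabanUV.T4Continuum.CountSeamJunction Summit.QuantumFields.BalabanUV.T4Continuum.LateMergers
open Summit.QuantumFields.BalabanUV.T4Continuum.HistoryFlow Summit.QuantumFields.BalabanUV.T4Continuum.HistoryRegeneration
open Summit.QuantumFields.BalabanUV.T4Continuum.HistoryTables Summit.QuantumFields.BalabanUV.T4Continuum.HistoryAssemblyTrees
open Summit.QuantumFields.BalabanUV.T4Continuum.HistoryAssemblyTerms Summit.QuantumFields.BalabanUV.T4Continuum.HistoryAssemblyPedigree
open Summit.QuantumFields.BalabanUV.T4Continuum.HistoryConstants Summit.QuantumFields.BalabanUV.T4Continuum.HistoryGen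
open Literature.MathematicalPhysics.QuantumFieldTheory.Balaban1983to89.B13ScaleTransfer
open Summit.QuantumFields.BalabanUV.T4Continuum.ZoneSkeleton Summit.QuantumFields.BalabanUV.T4Continuum.HistorySocketTH
open Summit.QuantumFields.BalabanUV.T4Continuum.HistoryCaps Summit.QuantumFields.BalabanUV.T4Continuum.HistoryAssemblyPrice
open Summit.QuantumFields.BalabanUV.T4Continuum.HistoryBankingLE Summit.QuantumFields.BalabanUV.T4Continuum.HistoryExitLE
open Summit.QuantumFields.BalabanUV.T4Continuum.HistoryAssemblyTreesLE Summit.QuantumFields.BalabanUV.T4Continuum.HistoryAssemblyTermsLE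
open Summit.QuantumFields.BalabanUV.T4Continuum.HistoryRealise Summit.QuantumFields.BalabanUV.T4Continuum.HistoryAssemblyRealiseLE
open Summit.QuantumFields.BalabanUV.T4Continuum.HistoryAssemblyMult Summit.QuantumFields.BalabanUV.T4Continuum.HistoryAssemblyMultKey
open Summit.QuantumFields.BalabanUV.T4Continuum.HistoryAssemblyRealiseRun Summit.QuantumFields.BalabanUV.T4Continuum.HistoryAssemblyRealiseMult
open Summit.QuantumFields.BalabanUV.T4Continuum.HistoryZones Summit.QuantumFields.BalabanUV.T4Continuum.HistoryRealiseCells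
open Summit.QuantumFields.BalabanUV.T4Continuum.HistoryRealiseCellsRun Summit.QuantumFields.BalabanUV.T4Continuum.HistoryAssemblyRealiseRunMult
open Summit.QuantumFields.BalabanUV.T4Continuum.HistoryRealiseCellsRunMult Summit.QuantumFields.BalabanUV.T4Continuum.HistoryAssemblyMultInstance
open Summit.QuantumFields.BalabanUV.T4Continuum.HistoryJoinsPlacedMember Summit.QuantumFields.BalabanUV.T4Continuum.PlacementSkeleton
open Summit.QuantumFields.BalabanUV.T4Continuum.HistoryJoinsPlacedMult Summit.QuantumFields.BalabanUV.T4Continuum.HistoryRealiseDistinct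
open Summit.QuantumFields.BalabanUV.T4Continuum.HistoryRegionTemplates Summit.QuantumFields.BalabanUV.T4Continuum.HistoryCaps
open Summit.QuantumFields.BalabanUV.T4Continuum.HistoryZoneEvolve (cth)
open Literature.MathematicalPhysics.QuantumFieldTheory.Balaban1983to89.B16SProfile (DropCtl)
open Summit.QuantumFields.BalabanUV.T4Continuum.HistoryRealiseCellsRunMultEnd Summit.QuantumFields.BalabanUV.T4Continuum.HistoryRealiseCellsRunMultEndD
open Summit.QuantumFields.BalabanUV.T4Continuum.HistoryRealiseCellsRunPinnedT3b Summit.QuantumFields.BalabanUV.T4Continuum.HistoryHybridRescale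
open Summit.QuantumFields.BalabanUV.T4Continuum.HistoryRealiseCellsRunApex (exists_const_schemeZ)
open Summit.QuantumFields.BalabanUV.T4Continuum.HistoryRealisePrint Summit.QuantumFields.BalabanUV.T4Continuum.HistoryRealiseWeak
open Summit.QuantumFields.BalabanUV.T4Continuum.HistoryRealisePrintReading Summit.QuantumFields.BalabanUV.T4Continuum.HistoryRealiseWeakReading
open Summit.QuantumFields.BalabanUV.T4Continuum.HistoryRealisePrintCells Summit.QuantumFields.BalabanUV.T4Continuum.HistoryRealiseWeakCells
open Summit.QuantumFields.BalabanUV.T4Continuum.HistoryRealiseCellsRunApexT3b Summit.QuantumFields.BalabanUV.T4Continuum.HistoryRealiseCellsRunApexT3bW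

open Summit.QuantumFields.BalabanUV.T4Continuum.HistoryRealiseCellsRunApexT3bWT Summit.QuantumFields.BalabanUV.T4Continuum.HistoryRealiseCellsRunPinnedT3bWT
open Summit.QuantumFields.BalabanUV.T4Continuum.HistoryRealiseCellsRunHeadlineT3bWT
open Summit.QuantumFields.BalabanUV.T4Continuum.HistoryRealiseCellsRunApexT3bWTV Summit.QuantumFields.BalabanUV.T4Continuum.HistoryBankingVolumePlug
open Summit.QuantumFields.BalabanUV.T4Continuum.HistoryRealiseCellsRunApexT3bWTVS
open Summit.QuantumFields.BalabanUV.T4Continuum.HistoryGenealogyRealise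
open Summit.QuantumFields.BalabanUV.T4Continuum.HistoryGenealogyInstantiate
open Summit.QuantumFields.BalabanUV.T4Continuum.B16HistoryIndexedRepr
open Summit.QuantumFields.BalabanUV.T4Continuum.B16HistoryIndexedTrunc
open Summit.QuantumFields.BalabanUV.T4Continuum.HistoryBankingDiscountCharge
open Summit.QuantumFields.BalabanUV.T4Continuum.HistoryBankingCreditRead
open Summit.QuantumFields.BalabanUV.T4Continuum.HistoryBankingFibreRoom
open Summit.QuantumFields.BalabanUV.T4Continuum.HistoryPriceKeys
open Summit.QuantumFields.BalabanUV.T4Continuum.HistoryRealiseCellsRunSupplyWTVS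
open Summit.QuantumFields.BalabanUV.T4Continuum.HistoryRealiseCellsRunSupplyKeysWTVS

open Summit.QuantumFields.BalabanUV.T4Continuum.HistoryRealiseCellsRunAssemblyWTVSData
open Summit.QuantumFields.BalabanUV.T4Continuum.HistoryRealiseCellsRunAssemblyWTVSDataL
open Summit.QuantumFields.BalabanUV.T4Continuum.HistoryRealiseCellsRunAssemblyWTVSDataLW
open Summit.QuantumFields.BalabanUV.T4Continuum.HistoryRealiseCellsRunAssemblyWTVSL
open Summit.QuantumFields.BalabanUV.T4Continuum.HistoryRealiseCellsRunApexT3bWTVSL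
open Summit.QuantumFields.BalabanUV.T4Continuum.HistoryBankingSharpShares (sBsharp)
open Summit.QuantumFields.BalabanUV.T4Continuum.HistoryBankingRoundingSupply (ellStar)
open Summit.QuantumFields.BalabanUV.T4Continuum.HistoryBankingRoundingUnrounded (sRunr ApFlat)
open Summit.QuantumFields.BalabanUV.T4Continuum.HistoryBankingRoundingTuned
open Summit.QuantumFields.BalabanUV.T4Continuum.HistoryBankingVolumeWindow
open Summit.QuantumFields.BalabanUV.T4Continuum.HistoryBankingVolumeSupply

open Summit.QuantumFields.BalabanUV.T4Continuum.HistoryBankingForestVolume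
open Summit.QuantumFields.BalabanUV.T4Continuum.HistoryBankingForestPlug
open Summit.QuantumFields.BalabanUV.T4Continuum.HistoryBankingAnchors82
open Summit.QuantumFields.BalabanUV.T4Continuum.HistoryBankingShrunkLedger82
open Summit.QuantumFields.BalabanUV.T4Continuum.HistoryBankingShrunkWitness82
open Summit.QuantumFields.BalabanUV.T4Continuum.HistoryBankingVolumeWindowCollar
open Summit.QuantumFields.BalabanUV.T4Continuum.HistoryBankingVolumeWindowShrunk82
open Summit.QuantumFields.BalabanUV.T4Continuum.B16HistoryWeightPlugW
open Summit.QuantumFields.BalabanUV.T4Continuum.HistoryRealiseCellsRunSupplyWTVSW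
open Summit.QuantumFields.BalabanUV.T4Continuum.HistoryRealiseCellsRunAssemblyWTVSDataLW
open Summit.QuantumFields.BalabanUV.T4Continuum.HistoryRealiseCellsRunAssemblyWTVSDataLP
open Summit.QuantumFields.BalabanUV.T4Continuum.HistoryRealiseCellsRunAssemblyWTVSLW
open Summit.QuantumFields.BalabanUV.T4Continuum.HistoryRealiseCellsRunAssemblyWTVSLP
open Summit.QuantumFields.BalabanUV.T4Continuum.HistoryBankingVolumeWindowLattice
open Summit.QuantumFields.BalabanUV.T4Continuum.HistoryRealiseCellsRunAssemblyWTVSLWP82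
open Summit.QuantumFields.BalabanUV.T4Continuum.HistoryRealiseCellsRunAssemblyWTVSDataLWL
open Literature.MathematicalPhysics.QuantumFieldTheory.Balaban1983to89.TreeLength Literature.MathematicalPhysics.QuantumFieldTheory.Balaban1983to89.B16MergeGeometry
open Summit.QuantumFields.BalabanUV.T4Continuum.HistoryAdmissible Summit.QuantumFields.BalabanUV.T4Continuum.HistoryGenealogyExtraction
open Summit.QuantumFields.BalabanUV.T4Continuum.HistoryGenealogyPedigree Summit.QuantumFields.BalabanUV.T4Continuum.HistoryTouchComponents
open Summit.QuantumFields.BalabanUV.T4Continuum.HistoryBankingSharpShares (ell)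
open Summit.QuantumFields.BalabanUV.T4Continuum.HistoryBankingRoundingSupply
open Summit.QuantumFields.BalabanUV.T4Continuum.B16HistoryReprChain Summit.QuantumFields.BalabanUV.T4Continuum.B16HistoryReprInstance
open Summit.QuantumFields.BalabanUV.T4Continuum.B16HistoryReprRead Summit.QuantumFields.BalabanUV.T4Continuum.B16HistoryReprReadCausal
open Summit.QuantumFields.BalabanUV.T4Continuum.B16HistoryStepDisplayPinned
open Summit.QuantumFields.BalabanUV.T4Continuum.HistoryRealiseCellsRunAssemblyWTVSLWLP82
open Summit.QuantumFields.BalabanUV.T4Continuum.B16HistoryTowerEndDataLWL Summit.QuantumFields.BalabanUV.T4Continuum.B16HistoryTowerEndDataLWR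

namespace Summit.QuantumFields.BalabanUV.T4Continuum.B16HistoryTowerEndLWRP82

noncomputable section

set_option synthInstance.maxSize 1024

/-! ## §1 The tower's reading, bundle and operations (abbreviations) and the plug at M5-2e's ledger over the rounded record -/

section Embed

variable {F : T4Family} {G : Type*} [GaugeGroup G] [MeasurableSpace G] [HaarData G] [RegularGaugeGroup G]
  {D : FiniteEpsData F G} {C : T4PrintedShapeBanking.Consts} {O : PrintedO1s} {θv : ℝ} {rr d n : ℕ} {hn : 0 < n}
  {g₀ : ℕ → ℝ} {os : List (ULoop F)} {cΛ M Φ β₀ : ℝ} {p₁ η η' κ κ₂ κᵥ : ℕ}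
  {P : Type} [DecidableEq P] {X : ℕ → ℕ → Type} {𝒢 : (K j : ℕ) → GoodClass (X K j)}
  [∀ K, MeasurableSpace (X K K)] {μ : (K : ℕ) → Measure (X K K)} [∀ K, IsFiniteMeasure (μ K)]
  {DomK' : ℕ → Type} {I' : (K : ℕ) → HIndex (DomK' K)}
  {Y : ℕ → Type} [∀ K, MeasurableSpace (Y K)] {νB : (K : ℕ) → Measure (Y K)} [∀ K, IsFiniteMeasure (νB K)]
  {𝒢' : (K : ℕ) → GoodClass (Y K)}

omit [RegularGaugeGroup G] in
/-- the tower record's READING: J2b's causal reading of the tower's choices [folklore] -/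
abbrev _root_.Summit.QuantumFields.BalabanUV.T4Continuum.B16HistoryTowerEndDataLWR.TowerReadDataLWR.ℛ
    (Dd : TowerReadDataLWR D C O θv rr d n hn g₀ os cΛ M Φ β₀ p₁ η η' κ κ₂ κᵥ P X 𝒢 μ I' Y νB 𝒢') :
    HistReading (skelFam Dd.T Dd.p₀) d :=
  Dd.𝒮.reading Dd.T Dd.p₀

omit [RegularGaugeGroup G] in
/-- the tower record's FACTOR BUNDLE: the pinned bundle at the rounded renewal letter [folklore] -/
abbrev _root_.Summit.QuantumFields.BalabanUV.T4Continuum.B16HistoryTowerEndDataLWR.TowerReadDataLWR.Φf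
    (Dd : TowerReadDataLWR D C O θv rr d n hn g₀ os cΛ M Φ β₀ p₁ η η' κ κ₂ κᵥ P X 𝒢 μ I' Y νB 𝒢') :
    HistFactors (skelFam Dd.T Dd.p₀) d :=
  factorsPinned Dd.T Dd.p₀ Dd.𝒮 Dd.B Dd.sB (sRrnd D O p₁ g₀ Dd.𝒮.R) cΛ M (gsOf D g₀) Dd.hcΛ Dd.hMΛ Dd.hℓ

omit [RegularGaugeGroup G] in
/-- the tower record's OPERATIONS: `reprFam` [folklore] -/
abbrev _root_.Summit.QuantumFields.BalabanUV.T4Continuum.B16HistoryTowerEndDataLWR.TowerReadDataLWR.RA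
    (Dd : TowerReadDataLWR D C O θv rr d n hn g₀ os cΛ M Φ β₀ p₁ η η' κ κ₂ κᵥ P X 𝒢 μ I' Y νB 𝒢') (K : ℕ) (t : ℝ) :
    Repr172R (𝒢 K K) (skelFam Dd.T Dd.p₀ K) :=
  reprFam Dd.T Dd.p₀ Dd.ρ₀ Dd.hρ₀ Dd.h0 Dd.B Dd.hB K t

omit [RegularGaugeGroup G] in
/-- **THE PLUG OF A ROUNDED TOWER RECORD AT M5-2e's LEDGER, per term** — LWLP82's `plug82L_of_histReadingLWL` over `TowerReadDataLWR`,
field for field (the per-term binders `hN`∕`hRm`∕`hRmS`∕`hRm2` are the tower's `newOK_run` ∕ flow rows; `hΛL` is `log_Λ_factorsPinned`).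
[folklore] -/
theorem plug82R_of_towerLWR
    (Dd : TowerReadDataLWR D C O θv rr d n hn g₀ os cΛ M Φ β₀ p₁ η η' κ κ₂ κᵥ P X 𝒢 μ I' Y νB 𝒢')
    (hIvL : ∀ K, (D.C ⟨K, F.m, g₀ K⟩).flow.InInterval
      (Real.exp (-(ellVolS82L C d κ₂ κᵥ cΛ M F.L θv ((1 + β₀) * F.L ^ d) (jvol82 d ((1 + β₀) * F.L ^ d)) / 2))) K) :
    ∀ K, Dd.K₀ ≤ K → ∀ τ ∈ HIndex.termSet (skelFam Dd.T Dd.p₀) K, ∀ x ∈ (Dd.ℛ.inputOf.run K τ).histV.comp K,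
      Real.exp (treeVol Dd.ℛ.L (Dd.ℛ.s K) (fun v => (v : ℝ)) (Dd.ℛ.inputOf.run K τ).pedMV
          (fun j => Real.log (Dd.Φf.Λ K j)) K (K, x)) ≤
        Real.exp (lifeCost (dictWT Prod.fst (Dd.ℛ.R K) C.n₁) (costT Prod.fst C K (Dd.ℛ.R K))
            ((Dd.ℛ.inputOf.run K τ).pedMV.genT (K, x))) *
          Real.exp (birthWT Prod.fst
            (fun m => cvol82 d (jvol82 d ((1 + β₀) * F.L ^ d)) ((1 + β₀) * F.L ^ d) * Real.log (Dd.Φf.Λ K m))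
            ((Dd.ℛ.inputOf.run K τ).pedMV.genT (K, x))) := by
  intro K hK τ hτ
  obtain ⟨⟨a, h, l, c⟩, -, hpe⟩ := Finset.mem_map.mp hτ
  have hτe : τ = ⟨K, a, (h, l, c)⟩ := hpe.symm
  subst hτe
  have hL0 : 0 < Dd.ℛ.L := by rw [show Dd.ℛ.L = F.L from Dd.hL]; exact lt_of_lt_of_le (by norm_num) (two_le_L F)
  have hL4 : 4 ≤ Dd.ℛ.L := by rw [show Dd.ℛ.L = F.L from Dd.hL]; exact Dd.hL4
  have hL1 : 1 ≤ F.L := le_trans (by norm_num) (two_le_L F)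
  have hdrop : ∀ m, DropCtl (Dd.ℛ.s K) m := by rw [show Dd.ℛ.s = runProfile F.L Dd.𝒮.R from Dd.hs]; exact Dd.hdrop K hK
  have vd : VolumeDisplaysS82 C d K (Dd.ℛ.R K) (fun t => Real.log (Dd.Φf.Λ K t)) ((1 + β₀) * F.L ^ d)
      (jvol82 d ((1 + β₀) * F.L ^ d)) :=
    volumeDisplaysS82L_of_log_eq_of_inInterval (D.C ⟨K, F.m, g₀ K⟩).flow (hIvL K)
      (log_Λ_factorsPinned Dd.T Dd.p₀ Dd.𝒮 Dd.B Dd.sB (sRrnd D O p₁ g₀ Dd.𝒮.R) cΛ M (gsOf D g₀) Dd.hcΛ Dd.hMΛ Dd.hℓ K)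
      Dd.hexpFL Dd.hdq Dd.hexpVL Dd.hκ₂ Dd.hκᵥ Dd.hcΛ Dd.hMΛ hL1 Dd.hE₂ Dd.hE₃pos Dd.hθv Dd.hA₀.ne' Dd.hβ₀ Dd.hp27 (Dd.h27 K hK)
      (Dd.h29 K hK) (fun t ht => Dd.isRj K t ht) le_rfl
  exact plug_of_shrunk82 (I := Dd.ℛ.inputOf.run K ⟨K, a, (h, l, c)⟩) (C := C)
    (Dd.𝒮.newOK_run Dd.T Dd.p₀ Dd.hν K ⟨K, a, (h, l, c)⟩)
    (fun t k => Dd.hRm K t k) (fun t k => Dd.hRmS K hK t k) (fun t => Dd.hRm2 K hK t) (Dd.hD K hK _ hτ) hL0 hL4 hdrop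
    (Dd.one_le_R K hK) Dd.hn₁ Dd.hE₂.le Dd.hE₃pos.le (fun j => Dd.Φf.one_le_Λ K j) vd.hΓ0 vd.hΓ vd.hj1 vd.hsmall vd.huS vd.huE₂
    vd.huE₃

omit [RegularGaugeGroup G] in
/-- **THE EMBEDDING AT THE ROUNDED LETTER**: a rounded tower record together with the rounding window `InInterval e^{−ℓ⋆∕2} K` at
`ℓ⋆ := ellStar C O F.L (O.d + 5) η η′ κ 1 Φ` and the LATTICE volume window for every cutoff IS a plug record `HistReadDataLP` at the weight
`cvol82 d (jvol82 d ((1+β₀)·L^d)) ((1+β₀)·L^d)` — `sR`∕`sR′ := sRrnd …` (print's `r_h`), `hRR`∕`hRR′` by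
`roundingRoomF_sharp_of_couplings` at `(t, Ap₁) := (O.d + 5, 1)` moved to the record's birth letters by `roundingRoomF_mono (hsB K)`, the
nine run-A slots by the J-chain, everything else as LWLP82's `toLP82L`. [folklore] -/
def _root_.Summit.QuantumFields.BalabanUV.T4Continuum.B16HistoryTowerEndDataLWR.TowerReadDataLWR.toLP82R
    (Dd : TowerReadDataLWR D C O θv rr d n hn g₀ os cΛ M Φ β₀ p₁ η η' κ κ₂ κᵥ P X 𝒢 μ I' Y νB 𝒢')
    (hIr : ∀ K, (D.C ⟨K, F.m, g₀ K⟩).flow.InInterval (Real.exp (-(ellStar C O F.L (O.d + 5) η η' κ 1 Φ / 2))) K)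
    (hIvL : ∀ K, (D.C ⟨K, F.m, g₀ K⟩).flow.InInterval
      (Real.exp (-(ellVolS82L C d κ₂ κᵥ cΛ M F.L θv ((1 + β₀) * F.L ^ d) (jvol82 d ((1 + β₀) * F.L ^ d)) / 2))) K) :
    HistReadDataLP D C O θv rr d n hn g₀ os (skelFam Dd.T Dd.p₀) I' (fun K => X K K) μ (fun K => 𝒢 K K) Y νB 𝒢' :=
  have hL1 : 1 ≤ F.L := le_trans (by norm_num) (two_le_L F)
  have hΓ0 : (0 : ℝ) ≤ (1 + β₀) * F.L ^ d := by have := Dd.hβ₀; positivity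
  { l₀ := Dd.l₀, vol := Dd.vol, l₀_pos := Dd.l₀_pos, vol_pos := Dd.vol_pos, K₀ := Dd.K₀, RA := Dd.RA,
    ρA := densFam Dd.T Dd.ρ₀,
    holdsA := holdsFam Dd.T Dd.p₀ Dd.ρ₀ Dd.hρ₀ Dd.h0 Dd.B Dd.hB Dd.hp₀,
    intA := Dd.intA, H2A := Dd.H2A, ℛ := Dd.ℛ, hL := Dd.hL, hs := Dd.hs, Φf := Dd.Φf,
    hR := histRead_of_hwPinned Dd.T Dd.p₀ Dd.𝒮 Dd.ρ₀ Dd.hρ₀ Dd.h0 Dd.B Dd.hB Dd.sB (sRrnd D O p₁ g₀ Dd.𝒮.R) cΛ M (gsOf D g₀)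
      Dd.hcΛ Dd.hMΛ Dd.hℓ Dd.hw Dd.hBρ Dd.hν0,
    isRj := Dd.isRj, one_le_R := Dd.one_le_R, hL4 := Dd.hL4, hprof := Dd.hprof, hdrop := Dd.hdrop,
    hN := fun K _ τ _ => Dd.𝒮.newOK_run Dd.T Dd.p₀ Dd.hν K τ,
    hRm := fun K _ _ _ t k => Dd.hRm K t k,
    hRmS := fun K hK _ _ t k => Dd.hRmS K hK t k,
    hRm2 := fun K hK _ _ t => Dd.hRm2 K hK t,
    hD := Dd.hD, hreg := Dd.hreg, hn₁ := Dd.hn₁, hE₂ := Dd.hE₂, hE₃ := Dd.hE₃pos.le,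
    wV := fun _ => cvol82 d (jvol82 d ((1 + β₀) * F.L ^ d)) ((1 + β₀) * F.L ^ d),
    hwV := fun _ _ => two_pow_le_cvol82 d _ hΓ0,
    hplug := plug82R_of_towerLWR Dd hIvL,
    sB := Dd.sB,
    sR := sRrnd D O p₁ g₀ Dd.𝒮.R,
    φB := Dd.φB, φR := Dd.φR, β' := Dd.β', β₀ := β₀,
    hF := fun K _ =>
      factorRead_factorsPinned Dd.T Dd.p₀ Dd.𝒮 Dd.B Dd.sB (sRrnd D O p₁ g₀ Dd.𝒮.R) cΛ M (gsOf D g₀) Dd.hcΛ Dd.hMΛ Dd.hℓ K,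
    hRR := fun K hK =>
      roundingRoomF_mono (Dd.hsB K) (fun _ => le_rfl)
        (roundingRoomF_sharp_of_couplings (t := O.d + 5) (Ap₁ := 1) Dd.hexpR Dd.hexpR' Dd.hexpB Dd.hη Dd.hη' Dd.hκ Dd.hp₀c
          one_ne_zero Dd.hγ₀ Dd.hA₁ Dd.hA₀ Dd.hΦ Dd.hE₂ Dd.hE₃pos.le hL1 Dd.hm (Dd.h29 K hK) (fun j hj => Dd.isRj K j hj)
          le_rfl (hIr K) (Dd.hφB K) (Dd.hφR K)),
    h29 := Dd.h29,
    huV := fun K _ τ _ q hq => by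
      obtain ⟨c, hc, rfl⟩ := mem_memOf.1 hq
      obtain ⟨x, -, rfl⟩ := Finset.mem_image.1 hc
      exact huθS82L_births_of_log_eq_of_inInterval (D.C ⟨K, F.m, g₀ K⟩).flow (hIvL K)
        (log_Λ_factorsPinned Dd.T Dd.p₀ Dd.𝒮 Dd.B Dd.sB (sRrnd D O p₁ g₀ Dd.𝒮.R) cΛ M (gsOf D g₀) Dd.hcΛ Dd.hMΛ Dd.hℓ K)
        Dd.hexpFL Dd.hdq Dd.hexpVL Dd.hκ₂ Dd.hκᵥ Dd.hcΛ Dd.hMΛ hL1 Dd.hE₂ Dd.hE₃pos Dd.hθv Dd.hA₀.ne' Dd.hβ₀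
        (fun t ht => Dd.isRj K t ht) le_rfl Prod.fst _ (births_le_of_step_le _ _ le_rfl),
    W := Dd.W, one_le_W := Dd.one_le_W, Wi := Dd.Wi, BAi := Dd.BAi, mi := Dd.mi, hWi := Dd.hWi, hBA := Dd.hBA,
    hmi := Dd.hmi, hρ := Dd.hρ, c₀ := Dd.c₀, n₁ := Dd.n₁, c₀_pos := Dd.c₀_pos, floor := Dd.floor,
    floor' := Dd.floor', sites := Dd.sites, sites' := Dd.sites', RB := Dd.RB, ρB := Dd.ρB, holdsB := Dd.holdsB,
    intB := Dd.intB, H2B := Dd.H2B, trunc := Dd.trunc, htr := Dd.htr, dB := Dd.dB, mup := Dd.mup, sB' := Dd.sB',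
    φB' := Dd.φB',
    sR' := sRrnd D O p₁ g₀ Dd.𝒮.R,
    φR' := Dd.φR',
    hRR' := fun K hK =>
      roundingRoomF_mono (Dd.hsB' K) (fun _ => le_rfl)
        (roundingRoomF_sharp_of_couplings (t := O.d + 5) (Ap₁ := 1) Dd.hexpR Dd.hexpR' Dd.hexpB Dd.hη Dd.hη' Dd.hκ Dd.hp₀c
          one_ne_zero Dd.hγ₀ Dd.hA₁ Dd.hA₀ Dd.hΦ Dd.hE₂ Dd.hE₃pos.le hL1 Dd.hm (Dd.h29 K hK) (fun j hj => Dd.isRj K j hj)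
          le_rfl (hIr K) (Dd.hφB' K) (Dd.hφR' K)),
    upB := Dd.upB, deadB_nonneg := Dd.deadB_nonneg, resumB := Dd.resumB, mup_bd := Dd.mup_bd, shA := Dd.shA,
    shB := Dd.shB, Wsh := Dd.Wsh, shell := Dd.shell, Cc := Dd.Cc, Rr := Dd.Rr, CcRec := Dd.CcRec, RrRec := Dd.RrRec,
    ν := Dd.ν, u := Dd.u, s₂ := Dd.s₂, q₀ := Dd.q₀, r := Dd.r, s := Dd.s, budget := Dd.budget, sum_r := Dd.sum_r,
    sum_u := Dd.sum_u, sum_s := Dd.sum_s, sum_s₂ := Dd.sum_s₂ }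

omit [RegularGaugeGroup G] in
/-- the embedding keeps the reading, the threshold, the bundle, the source radius and the truncation and FIXES the renewal letters to
print's rounded `r_h` [folklore] -/
theorem _root_.Summit.QuantumFields.BalabanUV.T4Continuum.B16HistoryTowerEndDataLWR.TowerReadDataLWR.toLP82R_data
    (Dd : TowerReadDataLWR D C O θv rr d n hn g₀ os cΛ M Φ β₀ p₁ η η' κ κ₂ κᵥ P X 𝒢 μ I' Y νB 𝒢')
    (hIr : ∀ K, (D.C ⟨K, F.m, g₀ K⟩).flow.InInterval (Real.exp (-(ellStar C O F.L (O.d + 5) η η' κ 1 Φ / 2))) K)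
    (hIvL : ∀ K, (D.C ⟨K, F.m, g₀ K⟩).flow.InInterval
      (Real.exp (-(ellVolS82L C d κ₂ κᵥ cΛ M F.L θv ((1 + β₀) * F.L ^ d) (jvol82 d ((1 + β₀) * F.L ^ d)) / 2))) K) :
    (Dd.toLP82R hIr hIvL).ℛ = Dd.ℛ ∧ (Dd.toLP82R hIr hIvL).K₀ = Dd.K₀ ∧ (Dd.toLP82R hIr hIvL).Φf = Dd.Φf ∧
      (Dd.toLP82R hIr hIvL).l₀ = Dd.l₀ ∧ (Dd.toLP82R hIr hIvL).trunc = Dd.trunc ∧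
      (Dd.toLP82R hIr hIvL).sR = sRrnd D O p₁ g₀ Dd.𝒮.R ∧ (Dd.toLP82R hIr hIvL).sR' = sRrnd D O p₁ g₀ Dd.𝒮.R :=
  ⟨rfl, rfl, rfl, rfl, rfl, rfl, rfl⟩

end Embed

/-! ## §2 The terminal theorem: the headline from SOME rounded tower-form record, for all small couplings -/

section SU

variable {F : T4Family} {N : ℕ} [NeZero N] {ℰ : LoopAverage (Matrix.specialUnitaryGroup (Fin N) ℂ)}

/-- **THE HEADLINE PREDICATE FROM A TOWER-FORM READING OF (1.72) AT PRINT's ROUNDED RENEWAL LETTER**: `ContinuumYM4Torus D` for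
(0.4)-block-averaged data on `SU(N)` with a measurable small-loop average, GIVEN `(B)` and `BetaPertHyp` BY NAME, the sign conventions,
the `_fsc` family's constants-only side conditions, TEN window-threshold letters `cΛ M Φ b₀ p₁ η η′ κ κ₂ κᵥ` (bound here; no `Lr`), and —
for all small-coupling tuned runs and every loop string — SOME rounded tower-form record `TowerReadDataLWR …`.  Proof: W4's
`continuumYM4Torus_of_histReadingLP_fsc` ∘ `forSmallCouplings_mono_inInterval₂` at the thresholds `e^{−ℓ⋆∕2}` (`ℓ⋆ := ellStar C O F.L
(O.d+5) η η′ κ 1 Φ`, rounding at print's `t = d+5`) and `e^{−ℓᵥ82ᴸ∕2}` (lattice volume) ∘ §1 `toLP82R`.  CONDITIONAL on everything the record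
displays; NE7b NOT proved; count 0∕9. [folklore] -/
theorem continuumYM4Torus_of_towerReadingLWR_fsc (D : FiniteEpsData F (Matrix.specialUnitaryGroup (Fin N) ℂ))
    (hBA : D.IsBlockAveraged ℰ) (hE : ℰ.MeasurableE)
    (hB : B16.EndStatementBPrinted D.C) (hβ : BetaPertHyp D.βfun) (hsign : B16.SignConventions D.C)
    {C : T4PrintedShapeBanking.Consts} {O : PrintedO1s}
    {rr : ℕ} {β₀ : ℝ} (h : ThresholdOK C F.L rr β₀) (hμ : 0 < C.μ) (d n : ℕ)
    (hκ₁ : (d : ℝ) * Real.log F.L + 2 * Real.log 2 ≤ C.κ₁) (hE₀ : Real.log (2 + birthMass C) ≤ C.E₀)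
    (hA₀ : 1 ≤ C.A₀) (hβ₀ : 0 < β₀) (hLβ : (F.L : ℝ) * β₀ ≤ 1) (hn₁ : 13 ≤ C.n₁) (hn : 0 < n)
    {θ θv : ℝ} (hθ : 0 < θ) (hslack : C.a + (θ + θv) ≤ O.γ₀ * O.A₁ ^ 2 / 2)
    (hE₂ : 0 < C.E₂) (hE₃ : 0 ≤ C.E₃) {sS : ℕ} (hsS : 1 ≤ sS)
    (hsmall : (((2 * cth 32 1 sS + 1) ^ d : ℕ) : ℝ) * (5 : ℝ) ^ d * ((max 1 (2 * 32 + 2) : ℕ) : ℝ) ≤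
      (F.L : ℝ) ^ (sS / 2) / 2)
    {θc : ℝ} (hθc0 : 0 ≤ θc) (hθc1 : θc < 1) (hθcs : 1 / 2 ≤ θc ^ sS)
    {cΛ M Φ b₀ : ℝ} {p₁ η η' κ κ₂ κᵥ : ℕ}
    (hRead : T4ContinuumYM4Torus.ForSmallCouplings D fun g₀ => ∀ os : List (ULoop F),
        ∃ (P : Type) (_ : DecidableEq P) (X : ℕ → ℕ → Type) (𝒢 : (K j : ℕ) → GoodClass (X K j))
          (_ : ∀ K, MeasurableSpace (X K K)) (μ : (K : ℕ) → Measure (X K K)) (_ : ∀ K, IsFiniteMeasure (μ K))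
          (DomK' : ℕ → Type) (I' : (K : ℕ) → HIndex (DomK' K))
          (Y : ℕ → Type) (_ : ∀ K, MeasurableSpace (Y K)) (νB : (K : ℕ) → Measure (Y K))
          (_ : ∀ K, IsFiniteMeasure (νB K)) (𝒢' : (K : ℕ) → GoodClass (Y K)),
          Nonempty (TowerReadDataLWR D C O θv rr d n hn g₀ os cΛ M Φ b₀ p₁ η η' κ κ₂ κᵥ P X 𝒢 μ I' Y νB 𝒢')) :
    T4ContinuumYM4Torus.ContinuumYM4Torus D :=
  continuumYM4Torus_of_histReadingLP_fsc D hBA hE hB hβ hsign h hμ d n hκ₁ hE₀ hA₀ hβ₀ hLβ hn₁ hn hθ hslack hE₂ hE₃ hsS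
    hsmall hθc0 hθc1 hθcs
    (forSmallCouplings_mono_inInterval₂ D
      (Real.exp_pos (-(ellStar C O F.L (O.d + 5) η η' κ 1 Φ / 2)))
      (Real.exp_pos (-(ellVolS82L C d κ₂ κᵥ cΛ M F.L θv ((1 + b₀) * F.L ^ d) (jvol82 d ((1 + b₀) * F.L ^ d)) / 2)))
      (fun g₀ hIr hIv hg os => by
        obtain ⟨P, iP, X, 𝒢, mX, μ, hμf, DomK', I', Y, mY, νB, hνf, 𝒢', ⟨Dd⟩⟩ := hg os
        exact ⟨fun _ => Unit, skelFam Dd.T Dd.p₀, inferInstance, DomK', I', fun K => X K K, inferInstance, μ, hμf,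
          fun K => 𝒢 K K, Y, mY, νB, hνf, 𝒢', ⟨Dd.toLP82R hIr hIv⟩⟩)
      hRead)

end SU

end

end Summit.QuantumFields.BalabanUV.T4Continuum.B16HistoryTowerEndLWRP82
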